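/-
Copyright (c) 2026 the pub-hodgecm-mathlib formalisation cell (harness21).  Prover seat hodgecm-mathlib-K2E3-p17 (g8), HCML Track B «K2-LIT» ∕ h413
(`stmt-HodgeConjecture-24833`), line `K2_E3_EllipticInputs`, unit U12 «Characters», road «GL₂-sc» NE half (NE lead K2E3-p23 (g6), road owner K2E5-p17 (g5),
dealer K2E3-plan (g4)), brick (2N-5) part 3: the `hball` hypothesis packaged Haar-a.e. on `G' = GL₂(F) ⧸ ϖ^ℤ` — the `N = 2` twin of ★ `K2E3GL3ModUniformizerNonEllBallSplit`
+ ★ `K2E3GL3ModUniformizerNonEllBall` §4 (K2E3-p23 (g5)).  2026-09-04.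
-/
import Summits.HodgeConjecture.HodgeConjecture.Theorems.K2E3GL2ModUniformizerBallBoundSplit   -- (2N-5) part 2 (this seat): the split mouth; brings 2N-0c F3, 2N-1, 2N-2, part 1
import Summits.HodgeConjecture.HodgeConjecture.Theorems.K2E3GL2ModUniformizerSeparableAE     -- ★ 2N-0d p858891 (K2E3-p23 g6): `ae_isCompact_centralizer_or_normalForm`
import Summits.HodgeConjecture.HodgeConjecture.Theorems.K2E3GL2FinConjBoxes                 -- ★ (2E-a1) p858857 (K2E5-p17 g5): `v_det_le_of_entries_le` at `Fin 2`
import Summits.HodgeConjecture.HodgeConjecture.Theorems.K2E3GL3ModUniformizerNonEllBall      -- ★ p858519 (K2E3-p23 g5): GENERIC §2∕§3 `v_sub_le_one`, `exists_nat_v_eq_exp_neg`, `inv_sqrt_le_of_eq_mul_sq`, `le_add_of_pow_eq_of_pow_mul_pow_le`; brings ★ `le_toReal_bound_mono`, ★ `normAbs_uniformizer_eq_inv`, ★ `v_eigenvalue_le_one_of_conj`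
import HarnessLib

/-!
# Road «GL₂-sc» NE half, brick (2N-5) part 3: `hball` PACKAGED — Haar-a.e. on `G' = GL₂(F) ⧸ ϖ^ℤ`, off the elliptic set,
# `∫_{Ω (R x̄)} ‖θ(z · x̄ · z⁻¹)‖ dμ'(z) ≤ M_θ · (c · C(m) · 2(2(R x̄ + 6 h(x̄) + L(x̄))+1) · q^{2h(x̄)} · |D♮(x̄)|^{-1∕2})` (Harish-Chandra 1970, VII §3; Jacquet–Langlands §7)

Cell `pub/hodgecm-mathlib` (D-0151), Track B «K2-LIT», crux H413 = `stmt-HodgeConjecture-24833`, route of record `HCCMUnconditional`.  Lane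
`--supports stmt-HodgeConjecture-24833 --as helper`; THEOREMS ONLY (no `def`, no `instance`, no `notation`, no named-fact hypothesis, no `sorry`); count-neutral.
The `N = 2` twin of ★ `K2E3GL3ModUniformizerNonEllBallSplit.exists_setIntegral_norm_conj_le_of_integral_split` + ★ `K2E3GL3ModUniformizerNonEllBall.ae_setIntegral_norm_conj_le_weight`
(road «GL-[M6]-sc», K2E3-p23 (g5)); at `N = 2` there is NO mixed case (★ 2N-0d `ae_isCompact_centralizer_or_normalForm`: a.e. `x̄` has compact centraliser or is
`mk(y · diag d · y⁻¹)` with `d` injective), so no `‖2‖⁻¹ q^{m+1}` factor and no `(2 : F) ≠ 0` hypothesis.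

This is the `hball` input of the non-elliptic estimates (2N-7, `hNE₂`) in the road's currency, for ANY radius `R : G' → ℕ`, with the weight written in three user-supplied
coordinates of `x̄ ∈ G'` (all quantified, no `def`): a height `h : G' → ℕ` with `x̄ ∈ Ω (h x̄)`, the normalised discriminant `δ : G' → ℝ≥0`,
`δ(mk g) = ‖disc χ_g‖ ∕ ‖det g‖²` (scale invariant), and a depth `L : G' → ℕ` with `q^{-L x̄} ≤ δ x̄` wherever `δ x̄ ≠ 0`.
Proof at a.e. `x̄` with NON-compact centraliser: ★ 2N-0d gives a lift `g = y · diag d · y⁻¹`, `d` injective; ★ B4-0 `exists_zpow_scalar_mul_integral_of_adBall` rescales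
`g` to an INTEGRAL representative `g₁ = ϖ^k g` of the same class (★ `mk_scalar_zpow_mul`) with `ϖ^{h} g₁⁻¹` integral; the split normal form rescales (§1); the
eigenvalues `t₀ ≠ t₁` of `g₁` are integral (★ `v_eigenvalue_le_one_of_conj`), `disc χ_{g₁} = (t₀ − t₁)²` (§1), `|disc χ_{g₁}| = q^{-L₀} ≤ 1`; the split mouth
★ (2N-5) part 2 `exists_setIntegral_norm_conj_le_split` (with `s := h`, `L := L₀`) bounds the ball integral by `M_θ·(c·C(m)·2(2(R+2h+L₀)+1)·|t₀ − t₁|⁻¹)`; finally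
`‖disc χ_{g₁}‖ = δ(x̄)·‖det g₁‖²`, `‖det g₁‖ ≥ q^{-2h}` (§1 `v_pow_pow_two_le_v_det`) give `|t₀ − t₁|⁻¹ = ‖disc χ_{g₁}‖^{-1∕2} ≤ q^{2h}·δ(x̄)^{-1∕2}` and
`L₀ ≤ 4h + L(x̄)` (★ generic §3 of the N = 3 file).
* §1 (algebra, any size `n`): `coe_scalar_mul`, `smul_conj`, `exists_glDiagonal_conj_eq`, `adBall_of_integral_of_inv`; (`Fin 2`): `charpoly_discr_of_conj_diagonal`,
  `v_pow_pow_two_le_v_det`; §2 **`ae_setIntegral_norm_conj_le_weight`**.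
HONEST LABEL: HC_CM is proved only modulo the 7 printed citations (2 remaining named inputs: hLiu418 = stmt-HodgeConjecture-24832, h413 = stmt-HodgeConjecture-24833) until
rung 0 closes; count-neutral helper, closes no socket.

## References
* [HarishChandra1970] Harish-Chandra (notes by G. van Dijk), *Harmonic Analysis on Reductive p-adic Groups*, LNM 162 (1970), Part VII §2 Theorem 18 p. 69, §3 pp. 72–73.
* [JacquetLanglands1970] H. Jacquet, R. P. Langlands, *Automorphic Forms on GL(2)*, LNM 114 (1970), §7 (local integrability of supercuspidal characters of `GL₂`).
-/

set_option autoImplicit false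
-- the mandated namespace repeats the single-problem summit's segment (`HodgeConjecture.HodgeConjecture`)
set_option linter.dupNamespace false

noncomputable section

open MeasureTheory Measure Set
open scoped MatrixGroups NNReal ENNReal WithZero
open Literature.NumberTheory.Automorphic Literature.NumberTheory.GaloisRepresentations Literature.NumberTheory.GaloisRepresentations.IsNonarchimedeanLocalField
open Summit.HodgeConjecture.HodgeConjecture.Cruxes.H413.K2E3GLnAdHeightBalls Summit.HodgeConjecture.HodgeConjecture.Cruxes.H413.K2E3GL2ModUniformizerFundamentalDomain
open Summit.HodgeConjecture.HodgeConjecture.Cruxes.H413.K2E3GL2ModUniformizerBallBoundSplit Summit.HodgeConjecture.HodgeConjecture.Cruxes.H413.K2E3GL2ModUniformizerSeparableAE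
open Summit.HodgeConjecture.HodgeConjecture.Cruxes.H413.K2E3GL3TruncatedCharSplitTorusRadius (v_eigenvalue_le_one_of_conj)
open Summit.HodgeConjecture.HodgeConjecture.Cruxes.H413.K2E3GL3ModUniformizerNonEllBallMixed (le_toReal_bound_mono normAbs_uniformizer_eq_inv)
open Summit.HodgeConjecture.HodgeConjecture.Cruxes.H413.K2E3GL3ModUniformizerNonEllBall (v_sub_le_one exists_nat_v_eq_exp_neg inv_sqrt_le_of_eq_mul_sq le_add_of_pow_eq_of_pow_mul_pow_le)

namespace Summit.HodgeConjecture.HodgeConjecture.Cruxes.H413.K2E3GL2ModUniformizerNonEllBall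

/-! ## §1 Algebra: integral representatives, split normal forms rescale, the discriminant and the determinant at `N = 2` -/
section Algebra

variable {F : Type*} [Field F]

/-- `↑(scalar u · g) = u • ↑g` (any size). [folklore] -/
theorem coe_scalar_mul {n : ℕ} (u : Fˣ) (g : GL (Fin n) F) :
    ((Matrix.GeneralLinearGroup.scalar (Fin n) u * g : GL (Fin n) F) : Matrix (Fin n) (Fin n) F) = (u : F) • (g : Matrix (Fin n) (Fin n) F) := by
  rw [Units.val_mul, Matrix.GeneralLinearGroup.coe_scalar, Matrix.scalar_apply, ← Matrix.smul_eq_diagonal_mul]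

/-- `u • (↑y · A · ↑y⁻¹) = ↑y · (u • A) · ↑y⁻¹` (any size). [folklore] -/
theorem smul_conj {n : ℕ} (u : F) (y : GL (Fin n) F) (A : Matrix (Fin n) (Fin n) F) :
    u • ((y : Matrix (Fin n) (Fin n) F) * A * ((y⁻¹ : GL (Fin n) F) : Matrix (Fin n) (Fin n) F)) =
      (y : Matrix (Fin n) (Fin n) F) * (u • A) * ((y⁻¹ : GL (Fin n) F) : Matrix (Fin n) (Fin n) F) := by
  rw [Matrix.mul_smul, Matrix.smul_mul]

/-- If `(g : Matrix) = y · diag d · y⁻¹` then every `d i ≠ 0` and `g = y · glDiagonal (mk0 ∘ d) · y⁻¹` in `GL_n` (any size). [folklore] -/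
theorem exists_glDiagonal_conj_eq {n : ℕ} {g y : GL (Fin n) F} {d : Fin n → F}
    (hg : (g : Matrix (Fin n) (Fin n) F) = (y : Matrix (Fin n) (Fin n) F) * Matrix.diagonal d * ((y⁻¹ : GL (Fin n) F) : Matrix (Fin n) (Fin n) F)) :
    ∃ hd : ∀ i, d i ≠ 0, g = y * glDiagonal n F (fun i => Units.mk0 (d i) (hd i)) * y⁻¹ := by
  have hdet : (Matrix.diagonal d).det ≠ 0 := by
    intro h0
    have h1 : (g : Matrix (Fin n) (Fin n) F).det = 0 := by rw [hg, Matrix.det_mul, Matrix.det_mul, h0, mul_zero, zero_mul]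
    exact (Matrix.det_ne_zero_of_left_inverse (B := ((g⁻¹ : GL (Fin n) F) : Matrix (Fin n) (Fin n) F))
      (by rw [← Units.val_mul, inv_mul_cancel, Units.val_one])) h1
  have hd : ∀ i, d i ≠ 0 := by
    intro i h0
    apply hdet
    rw [Matrix.det_diagonal]
    exact Finset.prod_eq_zero (Finset.mem_univ i) h0
  refine ⟨hd, Units.ext ?_⟩
  simp only [Units.val_mul, coe_glDiagonal, hg, Units.val_mk0]

/-- **`disc χ_g = (d₀ − d₁)²`** for `(g : Matrix) = y · diag(d₀, d₁) · y⁻¹` in `GL₂` (`χ` is conjugation invariant; Mathlib `Matrix.discr_fin_two`). [folklore] -/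
theorem charpoly_discr_of_conj_diagonal {g y : GL (Fin 2) F} {d : Fin 2 → F}
    (hg : (g : Matrix (Fin 2) (Fin 2) F) = (y : Matrix (Fin 2) (Fin 2) F) * Matrix.diagonal d * ((y⁻¹ : GL (Fin 2) F) : Matrix (Fin 2) (Fin 2) F)) :
    ((g : Matrix (Fin 2) (Fin 2) F)).charpoly.discr = (d 0 - d 1) ^ 2 := by
  rw [hg, Matrix.coe_units_inv, Matrix.charpoly_units_conj]
  have h : (Matrix.diagonal d).charpoly.discr = (Matrix.diagonal d).trace ^ 2 - 4 * (Matrix.diagonal d).det := Matrix.discr_fin_two (Matrix.diagonal d)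
  rw [h, Matrix.trace_fin_two, Matrix.det_diagonal, Fin.prod_univ_two, Matrix.diagonal_apply_eq, Matrix.diagonal_apply_eq]
  ring

variable [Valued F ℤᵐ⁰]

/-- **`g₁` integral and `ϖ^h g₁⁻¹` integral ⇒ `𝔅_h(g₁)`** (any size). [folklore] -/
theorem adBall_of_integral_of_inv {n : ℕ} {ϖ : F} {h : ℕ} {g : GL (Fin n) F} (hint : ∀ i j, Valued.v ((g : Matrix (Fin n) (Fin n) F) i j) ≤ 1)
    (hinv : ∀ i j, Valued.v (ϖ ^ h * ((g⁻¹ : GL (Fin n) F) : Matrix (Fin n) (Fin n) F) i j) ≤ 1) (i j k l : Fin n) :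
    Valued.v (ϖ ^ h * ((g : Matrix (Fin n) (Fin n) F) i j * ((g⁻¹ : GL (Fin n) F) : Matrix (Fin n) (Fin n) F) k l)) ≤ 1 := by
  rw [mul_left_comm, map_mul]
  exact mul_le_one' (hint i j) (hinv k l)

/-- If `ϖ^s y⁻¹` is integral then `|ϖ^s|² ≤ |det y|` in `GL₂` (`det(ϖ^s y⁻¹) = ϖ^{2s} ∕ det y` is integral, ★ 2E-a1 `v_det_le_of_entries_le`). [folklore] -/
theorem v_pow_pow_two_le_v_det {ϖ : F} {y : GL (Fin 2) F} {s : ℕ}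
    (hs : ∀ i j, Valued.v (ϖ ^ s * (((y⁻¹ : GL (Fin 2) F)) : Matrix (Fin 2) (Fin 2) F) i j) ≤ 1) :
    Valued.v ((ϖ ^ s) ^ 2) ≤ Valued.v ((y : GL (Fin 2) F) : Matrix (Fin 2) (Fin 2) F).det := by
  set Z : Matrix (Fin 2) (Fin 2) F := ϖ ^ s • (((y⁻¹ : GL (Fin 2) F)) : Matrix (Fin 2) (Fin 2) F) with hZ
  have hZ1 : Valued.v Z.det ≤ 1 := by
    have h := K2E3GL2FinConjBoxes.v_det_le_of_entries_le (M := 0) Z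
      (fun i j => by rw [WithZero.exp_zero, hZ, Matrix.smul_apply, smul_eq_mul]; exact hs i j)
    rwa [mul_zero, WithZero.exp_zero] at h
  have hZdet : Z.det * ((y : GL (Fin 2) F) : Matrix (Fin 2) (Fin 2) F).det = (ϖ ^ s) ^ 2 := by
    rw [hZ, Matrix.det_smul, Fintype.card_fin, mul_assoc, ← Matrix.det_mul, ← Units.val_mul, inv_mul_cancel, Units.val_one, Matrix.det_one, mul_one]
  rw [← hZdet, map_mul]
  exact mul_le_of_le_one_left' hZ1

end Algebra

/-! ## §2 `hball`, packaged on `GL₂(F) ⧸ ϖ^ℤ` -/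

variable {F : Type*} [Field F] [Valued F ℤᵐ⁰] [ValuativeRel F] [(Valued.v : Valuation F ℤᵐ⁰).Compatible] [IsNonarchimedeanLocalField F]
  [MeasurableSpace (GL (Fin 2) F)] [BorelSpace (GL (Fin 2) F)]
  {ϖ : F} (hϖ : Valued.v ϖ = WithZero.exp (-1 : ℤ)) (hϖ0 : ϖ ≠ 0)
  [((Subgroup.zpowers (Units.mk0 ϖ hϖ0)).map (Matrix.GeneralLinearGroup.scalar (Fin 2))).Normal]
  [MeasurableSpace (GL (Fin 2) F ⧸ (Subgroup.zpowers (Units.mk0 ϖ hϖ0)).map (Matrix.GeneralLinearGroup.scalar (Fin 2)))]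
  [BorelSpace (GL (Fin 2) F ⧸ (Subgroup.zpowers (Units.mk0 ϖ hϖ0)).map (Matrix.GeneralLinearGroup.scalar (Fin 2)))]
  (μ' : Measure (GL (Fin 2) F ⧸ (Subgroup.zpowers (Units.mk0 ϖ hϖ0)).map (Matrix.GeneralLinearGroup.scalar (Fin 2)))) [μ'.IsHaarMeasure]

include hϖ in
/-- **`hball` PACKAGED (Haar-a.e. on `G' = GL₂(F) ⧸ ϖ^ℤ`, off the elliptic set).**  There are `c : ℝ≥0` and `C : ℕ → ℝ≥0∞` finite such that for every `θ : G' → E` bounded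
by `M_θ` and vanishing off `Ω m`, every height `h` (`x̄ ∈ Ω (h x̄)`), every `δ` with `δ(mk g) = ‖disc χ_g‖ ∕ ‖det g‖²`, every depth `L` with `q^{-L x̄} ≤ δ x̄` where
`δ x̄ ≠ 0`, and every radius `R : G' → ℕ`: for `μ'`-a.e. `x̄` with NON-compact centraliser,
`∫_{Ω (R x̄)} ‖θ(z · x̄ · z⁻¹)‖ dμ'(z) ≤ M_θ · (c · (C m · 2(2(R x̄ + (6 h x̄ + L x̄))+1) · (q^{2 h x̄} · δ(x̄)^{-1∕2}))).toReal`.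
[cite: HarishChandra1970, Part VII §2 Theorem 18 p. 69; §3 pp. 72–73] [cite: JacquetLanglands1970, §7] -/
theorem ae_setIntegral_norm_conj_le_weight {E : Type*} [NormedAddCommGroup E]
    (Ω : ℕ → Set (GL (Fin 2) F ⧸ (Subgroup.zpowers (Units.mk0 ϖ hϖ0)).map (Matrix.GeneralLinearGroup.scalar (Fin 2))))
    (hmem : ∀ (n : ℕ) (z : GL (Fin 2) F),
      (QuotientGroup.mk z : GL (Fin 2) F ⧸ (Subgroup.zpowers (Units.mk0 ϖ hϖ0)).map (Matrix.GeneralLinearGroup.scalar (Fin 2))) ∈ Ω n ↔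
        ∀ i j k l, Valued.v (ϖ ^ n * ((z : Matrix (Fin 2) (Fin 2) F) i j * ((z⁻¹ : GL (Fin 2) F) : Matrix (Fin 2) (Fin 2) F) k l)) ≤ 1) :
    ∃ (c : ℝ≥0) (C : ℕ → ℝ≥0∞), (∀ m, C m ≠ ⊤) ∧
      ∀ (θ : GL (Fin 2) F ⧸ (Subgroup.zpowers (Units.mk0 ϖ hϖ0)).map (Matrix.GeneralLinearGroup.scalar (Fin 2)) → E) (Mθ : ℝ) (m : ℕ),
        (∀ x, ‖θ x‖ ≤ Mθ) → (∀ x, x ∉ Ω m → θ x = 0) →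
        ∀ (hgt : GL (Fin 2) F ⧸ (Subgroup.zpowers (Units.mk0 ϖ hϖ0)).map (Matrix.GeneralLinearGroup.scalar (Fin 2)) → ℕ)
          (δ : GL (Fin 2) F ⧸ (Subgroup.zpowers (Units.mk0 ϖ hϖ0)).map (Matrix.GeneralLinearGroup.scalar (Fin 2)) → ℝ≥0)
          (L R : GL (Fin 2) F ⧸ (Subgroup.zpowers (Units.mk0 ϖ hϖ0)).map (Matrix.GeneralLinearGroup.scalar (Fin 2)) → ℕ),
          (∀ x, x ∈ Ω (hgt x)) →
          (∀ g : GL (Fin 2) F, δ (QuotientGroup.mk g) =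
              normAbs F ((g : Matrix (Fin 2) (Fin 2) F)).charpoly.discr / normAbs F ((g : Matrix (Fin 2) (Fin 2) F)).det ^ 2) →
          (∀ x, δ x ≠ 0 → ((residueFieldCard F : ℝ≥0)⁻¹) ^ (L x) ≤ δ x) →
          ∀ᵐ x ∂μ', ¬ IsCompact ((Subgroup.centralizer {x} :
                Subgroup (GL (Fin 2) F ⧸ (Subgroup.zpowers (Units.mk0 ϖ hϖ0)).map (Matrix.GeneralLinearGroup.scalar (Fin 2)))) :
              Set (GL (Fin 2) F ⧸ (Subgroup.zpowers (Units.mk0 ϖ hϖ0)).map (Matrix.GeneralLinearGroup.scalar (Fin 2)))) →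
            ∫ z in Ω (R x), ‖θ (z * x * z⁻¹)‖ ∂μ' ≤
              Mθ * ((c : ℝ≥0∞) * (C m * ((2 * (2 * (R x + (6 * hgt x + L x)) + 1) : ℕ) : ℝ≥0∞) *
                (((residueFieldCard F : ℝ≥0) ^ (2 * hgt x) * (NNReal.sqrt (δ x))⁻¹) : ℝ≥0))).toReal := by
  obtain ⟨c, C, hC, hmouth⟩ := exists_setIntegral_norm_conj_le_split (E := E) hϖ hϖ0 μ' Ω hmem
  refine ⟨c, C, hC, fun θ Mθ m hM hsupp hgt δ L R hhgt hδ hL => ?_⟩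
  have hMθ : 0 ≤ Mθ := (norm_nonneg _).trans (hM 1)
  filter_upwards [ae_isCompact_centralizer_or_normalForm hϖ hϖ0 μ'] with x hx hnc
  obtain ⟨g, rfl, -, y, d, hd, hg⟩ := hx.resolve_left hnc
  -- the height and the integral representative `g₁ = ϖ^k g`
  set h : ℕ := hgt (QuotientGroup.mk g) with hhdef
  have hball : ∀ i j k l, Valued.v (ϖ ^ h * ((g : Matrix (Fin 2) (Fin 2) F) i j * ((g⁻¹ : GL (Fin 2) F) : Matrix (Fin 2) (Fin 2) F) k l)) ≤ 1 :=
    (hmem h g).1 (hhgt _)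
  obtain ⟨k, hint, hinv⟩ := exists_zpow_scalar_mul_integral_of_adBall hϖ hϖ0 hball
  set g₁ : GL (Fin 2) F := Matrix.GeneralLinearGroup.scalar (Fin 2) (Units.mk0 ϖ hϖ0 ^ k) * g with hg₁def
  have hmk : (QuotientGroup.mk g₁ : GL (Fin 2) F ⧸ (Subgroup.zpowers (Units.mk0 ϖ hϖ0)).map (Matrix.GeneralLinearGroup.scalar (Fin 2))) =
      QuotientGroup.mk g := mk_scalar_zpow_mul hϖ0 k g
  have hu : ((Units.mk0 ϖ hϖ0 ^ k : Fˣ) : F) ≠ 0 := (Units.mk0 ϖ hϖ0 ^ k).ne_zero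
  -- the split normal form of `g₁`: `g₁ = y · diag(u•d) · y⁻¹`
  have hg₁ : (g₁ : Matrix (Fin 2) (Fin 2) F) =
      (y : Matrix (Fin 2) (Fin 2) F) * Matrix.diagonal (((Units.mk0 ϖ hϖ0 ^ k : Fˣ) : F) • d) * ((y⁻¹ : GL (Fin 2) F) : Matrix (Fin 2) (Fin 2) F) := by
    rw [hg₁def, coe_scalar_mul, hg, smul_conj, ← Matrix.diagonal_smul]
  have hd₁ : Function.Injective (((Units.mk0 ϖ hϖ0 ^ k : Fˣ) : F) • d) := fun i j hij =>
    hd (mul_left_cancel₀ hu (by simpa [Pi.smul_apply, smul_eq_mul] using hij))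
  obtain ⟨hd0, hg₁'⟩ := exists_glDiagonal_conj_eq hg₁
  set t : Fin 2 → Fˣ := fun i => Units.mk0 ((((Units.mk0 ϖ hϖ0 ^ k : Fˣ) : F) • d) i) (hd0 i) with ht
  have htd : ∀ i, (t i : F) = (((Units.mk0 ϖ hϖ0 ^ k : Fˣ) : F) • d) i := fun i => rfl
  have h01 : (t 0 : F) ≠ t 1 := fun h' => absurd (hd₁ h') (by decide)
  have hy : ∀ i j, Valued.v ((((y * glDiagonal 2 F t * y⁻¹ : GL (Fin 2) F)) : Matrix (Fin 2) (Fin 2) F) i j) ≤ 1 := by rw [← hg₁']; exact hint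
  have ht1 : ∀ i, Valued.v (t i : F) ≤ 1 := fun i => v_eigenvalue_le_one_of_conj (coe_glDiagonal 2 F t) hy i
  -- `disc χ_{g₁} = (t₀ − t₁)² ≠ 0`, integral; `disc χ_g ≠ 0`
  have hdisc₁ : ((g₁ : Matrix (Fin 2) (Fin 2) F)).charpoly.discr = ((t 0 : F) - t 1) ^ 2 := charpoly_discr_of_conj_diagonal hg₁
  have hdiscg : ((g : Matrix (Fin 2) (Fin 2) F)).charpoly.discr ≠ 0 := by
    rw [charpoly_discr_of_conj_diagonal hg]
    exact pow_ne_zero 2 (sub_ne_zero.2 fun h' => absurd (hd h') (by decide))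
  have hdisc0 : ((g₁ : Matrix (Fin 2) (Fin 2) F)).charpoly.discr ≠ 0 := by
    rw [hdisc₁]; exact pow_ne_zero 2 (sub_ne_zero.2 h01)
  have hdisc1 : Valued.v ((g₁ : Matrix (Fin 2) (Fin 2) F)).charpoly.discr ≤ 1 := by
    rw [hdisc₁, map_pow]; exact pow_le_one₀ zero_le (v_sub_le_one (ht1 0) (ht1 1))
  -- `δ x̄ = ‖disc χ_{g₁}‖ ∕ ‖det g₁‖²`, nonzero
  have hdet0 : ((g₁ : Matrix (Fin 2) (Fin 2) F)).det ≠ 0 := ((Matrix.isUnit_iff_isUnit_det _).1 (Units.isUnit g₁)).ne_zero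
  have hdetg0 : ((g : Matrix (Fin 2) (Fin 2) F)).det ≠ 0 := ((Matrix.isUnit_iff_isUnit_det _).1 (Units.isUnit g)).ne_zero
  have hδx : δ (QuotientGroup.mk g) = normAbs F ((g₁ : Matrix (Fin 2) (Fin 2) F)).charpoly.discr / normAbs F ((g₁ : Matrix (Fin 2) (Fin 2) F)).det ^ 2 := by
    rw [← hmk]; exact hδ g₁
  have hδ0 : δ (QuotientGroup.mk g) ≠ 0 := by
    rw [hδ g]
    exact div_ne_zero ((_root_.map_ne_zero _).2 hdiscg) (pow_ne_zero _ ((_root_.map_ne_zero _).2 hdetg0))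
  have ha0 : normAbs F ((g₁ : Matrix (Fin 2) (Fin 2) F)).det ≠ 0 := (_root_.map_ne_zero _).2 hdet0
  have hDeq : normAbs F ((g₁ : Matrix (Fin 2) (Fin 2) F)).charpoly.discr = δ (QuotientGroup.mk g) * normAbs F ((g₁ : Matrix (Fin 2) (Fin 2) F)).det ^ 2 := by
    rw [hδx, div_mul_cancel₀ _ (pow_ne_zero _ ha0)]
  -- the depth exponent `L₀` of the representative and the depth hypothesis of T18₂
  obtain ⟨L₀, hL₀⟩ := exists_nat_v_eq_exp_neg hdisc0 hdisc1
  have hϖL : Valued.v (ϖ ^ L₀) = WithZero.exp (-(L₀ : ℤ)) := by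
    rw [map_pow, hϖ, ← WithZero.exp_nsmul]; congr 1; simp
  have hLdepth : Valued.v (ϖ ^ L₀ * ((t 0 : F) * t 1)) ≤ Valued.v (((t 0 : F) - t 1) ^ 2) := by
    rw [map_mul, hϖL, ← hL₀, hdisc₁]
    refine mul_le_of_le_one_right zero_le ?_
    rw [map_mul]
    exact mul_le_one' (ht1 0) (ht1 1)
  -- `𝔅_h(g₁)` and the bound at the representative
  have hs : ∀ i j k l, Valued.v (ϖ ^ h * (((y * glDiagonal 2 F t * y⁻¹ : GL (Fin 2) F) : Matrix (Fin 2) (Fin 2) F) i j *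
      (((y * glDiagonal 2 F t * y⁻¹)⁻¹ : GL (Fin 2) F) : Matrix (Fin 2) (Fin 2) F) k l)) ≤ 1 := by
    rw [← hg₁']; exact adBall_of_integral_of_inv hint hinv
  have key := hmouth θ Mθ m hM hsupp y t h01 ht1 h L₀ (R (QuotientGroup.mk g)) hs hLdepth
  rw [← hg₁', hmk] at key
  -- `‖ϖ‖ = q⁻¹`, `q^{-2h} ≤ ‖det g₁‖`, `‖disc χ_{g₁}‖ = q^{-L₀}`, `√‖disc χ_{g₁}‖ = |t₀ − t₁|`
  have hq : normAbs F ϖ = (residueFieldCard F : ℝ≥0)⁻¹ := normAbs_uniformizer_eq_inv hϖ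
  have hs0 : (0 : ℝ≥0) < (residueFieldCard F : ℝ≥0)⁻¹ := inv_residueFieldCard_pos
  have hs1 : (residueFieldCard F : ℝ≥0)⁻¹ < 1 := inv_residueFieldCard_lt_one
  have hdet : ((residueFieldCard F : ℝ≥0)⁻¹) ^ (2 * h) ≤ normAbs F ((g₁ : Matrix (Fin 2) (Fin 2) F)).det := by
    have hv := v_pow_pow_two_le_v_det (y := g₁) hinv
    have hn : normAbs F ((ϖ ^ h) ^ 2) ≤ normAbs F ((g₁ : Matrix (Fin 2) (Fin 2) F)).det :=
      normAbs_le_normAbs_iff.2 ((v_le_iff_valuation_le _ _).1 hv)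
    rwa [map_pow, map_pow, hq, ← pow_mul, mul_comm] at hn
  have hDL : ((residueFieldCard F : ℝ≥0)⁻¹) ^ L₀ = normAbs F ((g₁ : Matrix (Fin 2) (Fin 2) F)).charpoly.discr := by
    have hv : Valued.v ((g₁ : Matrix (Fin 2) (Fin 2) F)).charpoly.discr = Valued.v (ϖ ^ L₀) := by rw [hL₀, hϖL]
    have h1 := normAbs_le_normAbs_iff.2 ((v_le_iff_valuation_le _ _).1 hv.le)
    have h2' := normAbs_le_normAbs_iff.2 ((v_le_iff_valuation_le _ _).1 hv.ge)
    rw [map_pow, hq] at h1 h2'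
    exact le_antisymm h2' h1
  have hsqrt : NNReal.sqrt (normAbs F ((g₁ : Matrix (Fin 2) (Fin 2) F)).charpoly.discr) = normAbs F ((t 0 : F) - t 1) := by
    rw [hdisc₁, map_pow, NNReal.sqrt_sq]
  -- compare exponents and weights
  have hLle : L₀ ≤ L (QuotientGroup.mk g) + 2 * (2 * h) :=
    le_add_of_pow_eq_of_pow_mul_pow_le hs0 hs1 (hDL.trans hDeq) (hL _ hδ0) hdet
  refine le_toReal_bound_mono hMθ le_rfl le_rfl (hC m) ?_ ?_ key
  · omega
  · have hr0 : ((residueFieldCard F : ℝ≥0)⁻¹) ^ (2 * h) ≠ 0 := pow_ne_zero _ hs0.ne'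
    have := inv_sqrt_le_of_eq_mul_sq hDeq hdet hδ0 hr0
    rwa [inv_pow, inv_inv, hsqrt] at this

end Summit.HodgeConjecture.HodgeConjecture.Cruxes.H413.K2E3GL2ModUniformizerNonEllBall

end
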